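import Literature.MathematicalPhysics.QuantumFieldTheory.BalabanImbrieJaffe1984to88.BIJ88IdentityB1p296Proof

/-!
# `BalabanImbrieJaffe1984to88.BIJ88ScalarComposition311` — T. Bałaban, J. Imbrie, A. Jaffe, *Effective action and cluster properties of
the abelian Higgs model*, Commun. Math. Phys. **114** (1988) 257–315 [BalabanImbrieJaffe1988]: Sect. 5.14, p. 311 [PDF 55] — the
COMPOSITION OF THE SCALAR FIELD PROPAGATORS in the extraction of `𝒫^L_{k+1,loc}`, *"For scalar field propagators, we use the identity 2.42
from [7]: G_k(□,u_{k+1}) + a_k²L^{−2}G_k(□,u_{k+1})Q_k^*(u_{k+1})C^{(k)}(□,u_{k+1})Q_k(u_{k+1})G_k(□,u_{k+1}) = G^η_{k+1}(□,u_{k+1})"*, PROVED as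
a model instance on the tree's kernel-checked one-step carrier of [7] = [Balaban1982Higgs1] Sect. 2, `Balaban1983to89.B1RG242.StepData`,
where it IS `StepData.display242`; with the located sentence *"There are also small (O(e^{−cr(e_k)})) terms involving G_{k,loc}(u_{k+1}) −
G_k(□,u_{k+1}), C^{(k)}_{loc}(u_{k+1}) − C^{(k)}(□,u_{k+1}), and G_{k+1,loc}(u_{k+1}) − G_{k+1}(□,u_{k+1})"* made EXACT (the composed
expression with the localized propagators = `G^η_{k+1}` + three named difference terms, each carrying one of the printed differences, with
its operator-norm bound)

statement-level skeleton of published theorems with citation tags; proofs where landed; nothing here is a claim about the Yang–Mills mass gap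

PDF held: `paper:balaban1988-cmp114-bij-abelian-higgs-effective-action` (journal page = PDF page + 256); p. 311 [PDF 55] re-rendered this
session with `b2b-balaban-ref1/tools/g4png.py` and READ AS AN IMAGE (`scratch/c2pages/original-p055-x2.png` of the seat folder; the display
is garbled in the text layer); pp. 310, 312, 262–264 likewise; [BalabanImbrieJaffe1985] p. 303 (2.9) `QQ^* = I` and p. 313 (4.6.2)–(4.6.4)
from r15's renders `HOME/lit-balaban-r15/pages/1985-cmp97-bij-higgs-minimizers-p005/p015-x2.png`.

CITATION HEADER (verbatim, p. 311 [PDF 55]).  *"We compose propagators, using also terms from V^{(k)}_{const}(Λ₈^{(k)}). For gauge field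
propagators, we apply (5.5.11). For scalar field propagators, we use the identity 2.42 from [7]:
G_k(□,u_{k+1}) + a_k²L^{−2}G_k(□,u_{k+1})Q_k^*(u_{k+1})C^{(k)}(□,u_{k+1}) × Q_k(u_{k+1})G_k(□,u_{k+1}) = G^η_{k+1}(□,u_{k+1}).
There are also small (O(e^{−cr(e_k)})) terms involving G_{k,loc}(u_{k+1}) − G_k(□,u_{k+1}), C^{(k)}_{loc}(u_{k+1}) − C^{(k)}(□,u_{k+1}), and
G_{k+1,loc}(u_{k+1}) − G_{k+1}(□,u_{k+1}), and boundary terms as above involving C^{(k)}_{Λ₁₂^{(k)},loc}(u_{k+1}) − C^{(k)}_{loc}(u_{k+1}). We end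
up with scalar field propagators G^η_{k+1,loc}(u_{k+1})."*  [7] = T. Bałaban, *(Higgs)₂,₃ quantum fields in a finite volume I*, Commun. Math.
Phys. **85** (1982) [Balaban1982Higgs1], p. 612: *"G^ε_{k+1}(Ω,A) = a_k²(L^kε)^{−4}G^ε_k(Ω,A)Q^*_k(A)C^{(k),L^kε}(Ω,A)Q_k(A)G^ε_k(Ω,A) +
G^ε_k(Ω,A). (2.42)"*, (2.13) *"a_{k+1} = aa_k/(aL^{−2} + a_k)"*; its kernel-checked home in the tree is `Balaban1983to89.B1RG242` (r14/p34:
`StepData.display242`, any finite carrier — *"a torus, a parallelepiped □, or Ω = B^k(Ω^{(k)}) alike"*).  The operators of record entering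
the BIJ reading: [BalabanImbrieJaffe1985] (4.6.2) *"G_k(u_k) = [−Δ_{u_k} + a_kQ_k^*(u_k)Q_k(u_k)]^{−1}"*, (4.6.4) *"Δ_k(u_k) = a_kI −
a_k²Q_k(u_k)G_k(u_k)Q_k^*(u_k)"*, (2.9) *"QQ^* = I, where Q^* is the adjoint in the scalar product (2.2)"*; [BalabanImbrieJaffe1988] (2.39)
*"C^{(k)}_Λ(Ω,u) = [(Δ_k(Ω,u) + aL^{−2}Q(u)^*Q(u))|_Λ]^{−1}"*.

WHAT IS REPRODUCED.  SKELETON row **C2.Claim@310** of `HOME/lit-balaban-r16/ROWS-C2-part2.md` (*"W₆^{(k)′} bound (p.310) and 𝒫^L_{k+1,loc}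
extraction (p.311)"*; owner r16: *"𝒫^L_{k+1,loc} extraction identities absent"*), member «identity 2.42 from [7], p. 311» (cell `lit-balaban`,
HOME `run/shared/lean/pub/lit-balaban/`; Phase-2 seat p31 gen 12 = unit `lit-balaban-p31-g12`; TAKING line HOME/STATUS.md 2026-08-22T05:17:14Z;
referee ref-5).  Sibling of p02's `BIJ88IdentityB1p296Proof` (the identity of [7] quoted on p. 296 = `StepData.display221_succ`), whose
unit-lattice dictionary `gamma_unit` is used BY NAME.

WHAT IS PROVED HERE (0 `sorry`, standard axioms; theorems only, no `def`; `B1RG242` and `BIJ88IdentityB1p296Proof` imported, nothing restated).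
§1 **THE IDENTITY ON [7]'s CARRIER**: for `S : B1RG242.StepData ℝ ι κ ν` (H = −Δ_u on the fine lattice — on a cube □ with Neumann boundary
  conditions, on a region Ω, or on the whole torus: the carrier `ι` is arbitrary; Q_k, Q^*_k, Q, Q^* read on BIJ's UNIT lattice: α = a_k of
  (I.4.6.2), β = aL⁻² of (2.39)/(3.11)), under QQ^* = 1 and the invertibility of the arguments of G_k = (H + a_kP_k)⁻¹ and C^{(k)} = (aL⁻²P +
  Δ_k)⁻¹:  `composition311_step` — **G_k + a_k²·G_kQ^*_kC^{(k)}Q_kG_k = G^η_{k+1}** with `G^η_{k+1} = S.Gk1 = (H + γP_{k+1})⁻¹`, `Q_{k+1} = QQ_k`,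
  and `Gk1_eq_printed`: γ = a_{k+1}L⁻², **a_{k+1} = aa_k/(aL⁻² + a_k)** = [7] (2.13) — i.e. `G^η_{k+1}(□,u) = (−Δ_u + a_{k+1}L⁻²Q_{k+1}^*Q_{k+1})⁻¹`,
  the next propagator (I.4.6.2) ON THE η-LATTICE OF STEP k (before the rescaling (5.15.3); cf. p. 296 where the same `G^η_{k+1}` carries
  `a_{k+1}L⁻²`, G-C2-07); `composition311_aSeq` — the same with the closed form a_k = `B1.aSeq a L k` = a(1 − L⁻²)(1 − L^{−2k})⁻¹ of (I.4.6.3)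
  and a_{k+1} = `B1.aSeq a L (k+1)`; `composition311_of_next` / `composition311_of_posDef` — with [7]'s Euclidean structure (`StepData.ScalarProducts`)
  the two invertibility hypotheses follow from that of G^η_{k+1}'s argument alone, resp. from m² > 0.
§2 **THE PRINTED COEFFICIENT** `a_k²L^{−2}`: `composition311_asPrinted_fails` — on the one-site carrier (ι = κ = ν = `Unit`, H = 0, all
  averaging operators = 1, a = a_k = 1, L = 2, every hypothesis of §1 satisfied) the left side with the printed coefficient is `2·1` and
  `G^η_{k+1} = 5·1`: the display with `a_k²L^{−2}` is NOT an identity of the operators of record; the identity FORCES `a_k²` (§1).  READING NOTE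
  filed as HOME/GAPS.md **G-C2-25** (owner r16 to rule; same family as G-C2-07 = the p. 296 identity of [7], whose right-hand constant print gives
  as a_k where the identity forces a_{k+1}): with (I.4.6.2), (I.4.6.4), (2.39) and the adjoints of (I.2.9)/(3.11) the unit-lattice dictionary of
  [7] (2.42) is α = a_k, β = aL⁻² (confirmed by p. 296's own `aL⁻²I − a²L⁻⁴QC^{(k)}Q^*`), so the coefficient of the middle term is α² = a_k²;
  the printed extra `L^{−2}` has no counterpart (a slip of the same kind as (5.15.3)'s Jacobian G-C2-10 or p. 296's index); invisible
  downstream — the identity is used on p. 311 only structurally (*"We compose propagators"*), no estimate depends on the coefficient.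
§3 **THE LOCALIZED VERSION, EXACT** (`composition311_localized`, any ring): with `G′ = G_k + D₁` (D₁ = G_{k,loc} − G_k(□)), `C′ = C^{(k)} + E`
  (E = C^{(k)}_{loc} − C^{(k)}(□)) in the composed expression, `G′ + c·G′XC′YG′ = (G_k + c·G_kXC^{(k)}YG_k) + R`, `R = D₁ + c·(D₁XC′YG′ + G_kXEYG′ +
  G_kXC^{(k)}YD₁)` — every term of `R` carries exactly one of the printed differences (telescoping order: first slot where the localized
  propagator differs); with §1, `G_{k,loc} + c·G_{k,loc}Q^*_kC^{(k)}_{loc}Q_kG_{k,loc} = G^η_{k+1} + R` (`composition311_localized_step`), and the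
  third printed difference enters when `G^η_{k+1}` is in turn replaced by `G^η_{k+1,loc}`: `… = G^η_{k+1,loc} + (R − D₂)`, D₂ = G_{k+1,loc} − G_{k+1}
  (`composition311_localized_step'`).  `norm_remainder311_le` (normed ring): ‖R‖ ≤ ‖D₁‖ + |c|(‖D₁‖‖X‖‖C′‖‖Y‖‖G′‖ + ‖G_k‖‖X‖‖E‖‖Y‖‖G′‖ +
  ‖G_k‖‖X‖‖C^{(k)}‖‖Y‖‖D₁‖), whence `norm_remainder311_le_of_small`: if ‖D₁‖, ‖E‖ ≤ δ then ‖R‖ ≤ (1 + |c|‖X‖‖Y‖(‖C′‖‖G′‖ + ‖G_k‖‖G′‖ +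
  ‖G_k‖‖C^{(k)}‖))·δ — the printed *"small (O(e^{−cr(e_k)})) terms"* once δ = O(e^{−cr(e_k)}) ((2.31) for the G's, row C2.Eq2.31; (2.47)-type for
  C^{(k)}, row C2.Eq2.47 — INPUTS, not proved here).
HONEST SCOPE.  (a) The carrier is [7]'s finite-lattice matrix model with `QQ^* = 1` as printed in (I.2.9); the concrete torus operators
`Q_k(u)` (`BIJ85BlockAveragesTorusK.qCovK`), `G_k(u)` (`BIJ85ScalarPropagatorTorusK.exists_GK`, whole torus) are not threaded into a
`StepData` here (no cube-Neumann `G_k(□,u)` with body exists in the tree; cf. r18's `C2S14-CLOSURE.md` §3.6).  (b) The *"boundary terms as above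
involving C^{(k)}_{Λ₁₂,loc} − C^{(k)}_{loc}"*, the gauge-field half ((5.5.11), row C2.Eq5.5.1-5.5.12, PROVED `eq5511`) and the assembly *"Altogether we
have written V_const + 𝒫̃_{k+1} = 𝒫^L_{k+1,loc} + Σ_X W₆″(X)"* are NOT in this file (companion `BIJ88Extraction311`, announced).  (c) No bound of
the paper is asserted; §3's norm statement is generic ring arithmetic with the smallness of the differences as hypotheses.  NOT summit progress.
-/

namespace Literature.MathematicalPhysics.QuantumFieldTheory.BalabanImbrieJaffe1984to88.BIJ88ScalarComposition311

open Literature.MathematicalPhysics.QuantumFieldTheory.Balaban1983to89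
open Literature.MathematicalPhysics.QuantumFieldTheory.Balaban1983to89.B1RG242
open BIJ88IdentityB1p296Proof (gamma_unit)
open Matrix

noncomputable section

/-! ## §1  The identity 2.42 of [7] on the one-step carrier `B1RG242.StepData`, BIJ's unit-lattice reading -/

section Step

variable {ι κ ν : Type*} [Fintype ι] [Fintype κ] [Fintype ν] [DecidableEq ι] [DecidableEq κ] [DecidableEq ν]
variable (S : StepData ℝ ι κ ν)

/-- **p. 311, «the identity 2.42 from [7]», PROVED** (model instance on `B1RG242.StepData`, BIJ's unit lattice: α = a_k of (I.4.6.2),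
β = aL⁻² of (2.39)): under QQ^* = 1 and the invertibility of the arguments of `G_k = (H + a_kQ_k^*Q_k)⁻¹` and `C^{(k)} = (aL⁻²Q^*Q + Δ_k)⁻¹`,
`G_k + a_k²·G_kQ_k^*C^{(k)}Q_kG_k = G^η_{k+1}` with `G^η_{k+1} = S.Gk1 = (H + γ(QQ_k)^*(QQ_k))⁻¹` — it IS `StepData.display242`; the coefficient
is a_k² (print: a_k²L^{−2}, §2 and G-C2-25). [cite: BalabanImbrieJaffe1988, p.311 (Sect. 5.14)] -/
theorem composition311_step {ak : ℝ} (hα : S.α = ak) (hQ : S.Q * S.Qs = 1) (hαβ : S.α + S.β ≠ 0)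
    (hG : IsUnit (S.H + S.α • S.Pk)) (hC : IsUnit (S.β • S.P + S.Δk)) :
    S.Gk + ak ^ 2 • (S.Gk * S.Qks * S.Ck * S.Qk * S.Gk) = S.Gk1 := by
  rw [S.display242 hQ hαβ hG hC, hα, add_comm]

omit [DecidableEq κ] [DecidableEq ν] in
/-- **`G^η_{k+1}` identified**: with α = a_k, β = aL⁻² (a, a_k, L > 0) the right side of the p. 311 display is
`G^η_{k+1}(□,u_{k+1}) = (−Δ_u + a_{k+1}L⁻²·Q_{k+1}^*Q_{k+1})⁻¹`, `Q_{k+1} = QQ_k`, with **a_{k+1} = aa_k/(aL⁻² + a_k)** of [7] (2.13) — the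
propagator (I.4.6.2) of the next step on the η-lattice of step k (p. 296 writes the same `G^η_{k+1}` with `a_{k+1}L⁻²`, G-C2-07; p02's
`gamma_unit`). [cite: BalabanImbrieJaffe1988, p.311 (Sect. 5.14)] -/
theorem Gk1_eq_printed {a ak L : ℝ} (ha : 0 < a) (hak : 0 < ak) (hL : 0 < L) (hα : S.α = ak) (hβ : S.β = a * L⁻¹ ^ 2) :
    S.Gk1 = (S.H + (a * ak / (a * (L ^ 2)⁻¹ + ak) * L⁻¹ ^ 2) • (S.Qk1s * S.Qk1))⁻¹ := by
  rw [StepData.Gk1, StepData.Pk1, gamma_unit S ha hak hL hα hβ]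

/-- **The p. 311 display with everything printed made explicit** (a, a_k, L > 0; α = a_k, β = aL⁻²): under QQ^* = 1 and the two
invertibility hypotheses, `G_k + a_k²·G_kQ_k^*C^{(k)}Q_kG_k = (H + a_{k+1}L⁻²·Q_{k+1}^*Q_{k+1})⁻¹`, a_{k+1} = aa_k/(aL⁻² + a_k).
[cite: BalabanImbrieJaffe1988, p.311 (Sect. 5.14)] -/
theorem composition311_printed {a ak L : ℝ} (ha : 0 < a) (hak : 0 < ak) (hL : 0 < L) (hα : S.α = ak) (hβ : S.β = a * L⁻¹ ^ 2)
    (hQ : S.Q * S.Qs = 1) (hG : IsUnit (S.H + S.α • S.Pk)) (hC : IsUnit (S.β • S.P + S.Δk)) :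
    S.Gk + ak ^ 2 • (S.Gk * S.Qks * S.Ck * S.Qk * S.Gk)
      = (S.H + (a * ak / (a * (L ^ 2)⁻¹ + ak) * L⁻¹ ^ 2) • (S.Qk1s * S.Qk1))⁻¹ := by
  have hαβ : S.α + S.β ≠ 0 := by rw [hα, hβ]; positivity
  rw [composition311_step S hα hQ hαβ hG hC, Gk1_eq_printed S ha hak hL hα hβ]

/-- The identity with the closed form **a_k = `B1.aSeq a L k` = a(1 − L⁻²)(1 − L^{−2k})⁻¹** of (I.4.6.3) inside G_k, Δ_k, C^{(k)} and
**a_{k+1} = `B1.aSeq a L (k+1)`** in `G^η_{k+1}` (`B1.aSeq_succ` = [7] (2.13)), 1 ≤ k, L > 1. [cite: BalabanImbrieJaffe1988, p.311 (Sect. 5.14)] -/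
theorem composition311_aSeq {a L : ℝ} {k : ℕ} (ha : 0 < a) (hL : 1 < L) (hk : 1 ≤ k) (hα : S.α = B1.aSeq a L k)
    (hβ : S.β = a * L⁻¹ ^ 2) (hQ : S.Q * S.Qs = 1) (hG : IsUnit (S.H + S.α • S.Pk)) (hC : IsUnit (S.β • S.P + S.Δk)) :
    S.Gk + B1.aSeq a L k ^ 2 • (S.Gk * S.Qks * S.Ck * S.Qk * S.Gk)
      = (S.H + (B1.aSeq a L (k + 1) * L⁻¹ ^ 2) • (S.Qk1s * S.Qk1))⁻¹ := by
  rw [B1.aSeq_succ ha hL hk]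
  exact composition311_printed S ha (B1.aSeq_pos ha hL hk) (lt_trans one_pos hL) hα hβ hQ hG hC

variable {S} {WE : Matrix ι ι ℝ} {WK : Matrix κ κ ℝ} {WM : Matrix ν ν ℝ}

/-- With [7]'s Euclidean structure (1.5) (`StepData.ScalarProducts`: Q^*_k, Q^* the adjoints for the weighted scalar products — here (I.2.2) —,
α, β > 0, H = −Δ_u ≥ 0) the invertibility of the arguments of G_k and C^{(k)} follows from that of G^η_{k+1}'s argument (`B1RG242.isUnit_prev_of_next`,
`isUnit_C_of_next` — [7] p. 611 *"It is so"*). [cite: BalabanImbrieJaffe1988, p.311 (Sect. 5.14)] -/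
theorem composition311_of_next (E : S.ScalarProducts WE WK WM) {ak : ℝ} (hα : S.α = ak) (hQ : S.Q * S.Qs = 1)
    (hnext : IsUnit (S.H + S.γ • S.Pk1)) :
    S.Gk + ak ^ 2 • (S.Gk * S.Qks * S.Ck * S.Qk * S.Gk) = S.Gk1 :=
  composition311_step S hα hQ E.αβ_ne (StepData.isUnit_prev_of_next E hnext) (StepData.isUnit_C_of_next E hnext)

/-- With m² > 0 (more generally: H positive definite for the fine scalar product) nothing needs to be assumed beyond [7]'s Euclidean structure
and QQ^* = 1 (`B1RG242.StepData.display242_of_posDef`): G^η_{k+1} exists and the p. 311 identity holds. [cite: BalabanImbrieJaffe1988, p.311 (Sect. 5.14)] -/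
theorem composition311_of_posDef (E : S.ScalarProducts WE WK WM) {ak : ℝ} (hα : S.α = ak) (hQ : S.Q * S.Qs = 1)
    (hH : ∀ φ, φ ≠ 0 → 0 < φ ⬝ᵥ (WE *ᵥ (S.H *ᵥ φ))) :
    IsUnit (S.H + S.γ • S.Pk1) ∧ S.Gk + ak ^ 2 • (S.Gk * S.Qks * S.Ck * S.Qk * S.Gk) = S.Gk1 :=
  ⟨(StepData.display242_of_posDef E hQ hH).1, composition311_of_next E hα hQ (StepData.display242_of_posDef E hQ hH).1⟩

end Step

/-! ## §2  The printed coefficient `a_k²L^{−2}` is not the coefficient of the identity (one-site witness) -/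

section Witness

/-- kernel: on `1 × 1` matrices, `(c·1)⁻¹ = c⁻¹·1` for `c ≠ 0`. [folklore] -/
private theorem inv_smul_one_unit {c : ℝ} (hc : c ≠ 0) :
    (c • (1 : Matrix Unit Unit ℝ))⁻¹ = c⁻¹ • (1 : Matrix Unit Unit ℝ) := by
  apply Matrix.inv_eq_left_inv
  rw [smul_mul_smul_comm, one_mul, inv_mul_cancel₀ hc, one_smul]

/-- kernel: `c·1` is invertible on `1 × 1` matrices for `c ≠ 0`. [folklore] -/
private theorem isUnit_smul_one_unit {c : ℝ} (hc : c ≠ 0) : IsUnit (c • (1 : Matrix Unit Unit ℝ)) :=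
  IsUnit.of_mul_eq_one (c⁻¹ • (1 : Matrix Unit Unit ℝ))
    (by rw [smul_mul_smul_comm, one_mul, mul_inv_cancel₀ hc, one_smul])

/-- kernel: `a·1 = b·1` on `1 × 1` matrices forces `a = b`. [folklore] -/
private theorem eq_of_smul_one_unit_eq {a b : ℝ} (h : a • (1 : Matrix Unit Unit ℝ) = b • (1 : Matrix Unit Unit ℝ)) : a = b := by
  have h1 := congr_fun (congr_fun h ()) ()
  simpa using h1

/-! The one-site step datum of the witness is `W := ⟨0, 1, 1, 1, 1, 1, 1·2⁻²⟩ : StepData ℝ Unit Unit Unit` — ι = κ = ν = `Unit`, `H = 0` (the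
Neumann Laplacian of a single site), all averaging operators `= 1`, `α = a_k = 1`, `β = aL⁻² = 1/4` (a = 1, L = 2); the lemmas below take it
as `hS : S = W` so that this file declares theorems only. -/

variable {S : StepData ℝ Unit Unit Unit}

/-- kernel (witness arithmetic): `P_k = 1`. [folklore] -/
private theorem witness_Pk (hS : S = (StepData.mk 0 1 1 1 1 1 (1 * (2 : ℝ)⁻¹ ^ 2) : StepData ℝ Unit Unit Unit)) : S.Pk = 1 := by subst hS; simp [StepData.Pk]

/-- kernel (witness arithmetic): `P = 1`. [folklore] -/
private theorem witness_P (hS : S = (StepData.mk 0 1 1 1 1 1 (1 * (2 : ℝ)⁻¹ ^ 2) : StepData ℝ Unit Unit Unit)) : S.P = 1 := by subst hS; simp [StepData.P]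

/-- kernel (witness arithmetic): `β = 1/4`. [folklore] -/
private theorem witness_β (hS : S = (StepData.mk 0 1 1 1 1 1 (1 * (2 : ℝ)⁻¹ ^ 2) : StepData ℝ Unit Unit Unit)) : S.β = 4⁻¹ := by subst hS; norm_num

/-- kernel (witness arithmetic): the argument of `G_k` is `1·1`. [folklore] -/
private theorem witness_Gk_arg (hS : S = (StepData.mk 0 1 1 1 1 1 (1 * (2 : ℝ)⁻¹ ^ 2) : StepData ℝ Unit Unit Unit)) : S.H + S.α • S.Pk = (1 : ℝ) • (1 : Matrix Unit Unit ℝ) := by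
  rw [witness_Pk hS]; subst hS; simp

/-- kernel (witness arithmetic): `G_k = 1`. [folklore] -/
private theorem witness_Gk (hS : S = (StepData.mk 0 1 1 1 1 1 (1 * (2 : ℝ)⁻¹ ^ 2) : StepData ℝ Unit Unit Unit)) : S.Gk = 1 := by
  rw [StepData.Gk, witness_Gk_arg hS, one_smul, inv_one]

/-- kernel (witness arithmetic): `Δ_k = 0`. [folklore] -/
private theorem witness_Δk (hS : S = (StepData.mk 0 1 1 1 1 1 (1 * (2 : ℝ)⁻¹ ^ 2) : StepData ℝ Unit Unit Unit)) : S.Δk = 0 := by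
  rw [StepData.Δk, witness_Gk hS]; subst hS; simp

/-- kernel (witness arithmetic): the argument of `C^{(k)}` is `(1/4)·1`. [folklore] -/
private theorem witness_Ck_arg (hS : S = (StepData.mk 0 1 1 1 1 1 (1 * (2 : ℝ)⁻¹ ^ 2) : StepData ℝ Unit Unit Unit)) : S.β • S.P + S.Δk = (4⁻¹ : ℝ) • (1 : Matrix Unit Unit ℝ) := by
  rw [witness_P hS, witness_Δk hS, witness_β hS, add_zero]

/-- kernel (witness arithmetic): `C^{(k)} = 4·1`. [folklore] -/
private theorem witness_Ck (hS : S = (StepData.mk 0 1 1 1 1 1 (1 * (2 : ℝ)⁻¹ ^ 2) : StepData ℝ Unit Unit Unit)) : S.Ck = (4 : ℝ) • (1 : Matrix Unit Unit ℝ) := by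
  rw [StepData.Ck, witness_Ck_arg hS, inv_smul_one_unit (by norm_num)]; norm_num

/-- kernel (witness arithmetic): `γ = 1/5`. [folklore] -/
private theorem witness_γ (hS : S = (StepData.mk 0 1 1 1 1 1 (1 * (2 : ℝ)⁻¹ ^ 2) : StepData ℝ Unit Unit Unit)) : S.γ = 5⁻¹ := by
  rw [StepData.γ, witness_β hS]; subst hS; norm_num

/-- kernel (witness arithmetic): `G^η_{k+1} = 5·1`. [folklore] -/
private theorem witness_Gk1 (hS : S = (StepData.mk 0 1 1 1 1 1 (1 * (2 : ℝ)⁻¹ ^ 2) : StepData ℝ Unit Unit Unit)) : S.Gk1 = (5 : ℝ) • (1 : Matrix Unit Unit ℝ) := by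
  rw [StepData.Gk1, StepData.Pk1, StepData.Qk1s, StepData.Qk1, witness_γ hS]
  subst hS
  simp only [Matrix.one_mul, zero_add]
  rw [inv_smul_one_unit (by norm_num)]; norm_num

/-- kernel (witness arithmetic): the composed expression with an arbitrary coefficient `c` is `(1 + 4c)·1`. [folklore] -/
private theorem witness_lhs (hS : S = (StepData.mk 0 1 1 1 1 1 (1 * (2 : ℝ)⁻¹ ^ 2) : StepData ℝ Unit Unit Unit)) (c : ℝ) :
    S.Gk + c • (S.Gk * S.Qks * S.Ck * S.Qk * S.Gk) = (1 + 4 * c) • (1 : Matrix Unit Unit ℝ) := by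
  rw [witness_Gk hS, witness_Ck hS]
  subst hS
  simp only [Matrix.one_mul, Matrix.mul_one, smul_smul, add_smul, one_smul, mul_comm c 4]

/-- kernel (witness arithmetic): all four hypotheses of §1 hold on the witness. [folklore] -/
private theorem witness_hyps (hS : S = (StepData.mk 0 1 1 1 1 1 (1 * (2 : ℝ)⁻¹ ^ 2) : StepData ℝ Unit Unit Unit)) :
    S.Q * S.Qs = 1 ∧ S.α + S.β ≠ 0 ∧ IsUnit (S.H + S.α • S.Pk) ∧ IsUnit (S.β • S.P + S.Δk) := by
  refine ⟨by subst hS; simp, by subst hS; norm_num, ?_, ?_⟩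
  · rw [witness_Gk_arg hS]; exact isUnit_smul_one_unit one_ne_zero
  · rw [witness_Ck_arg hS]; exact isUnit_smul_one_unit (by norm_num)

/-- **The display with the printed coefficient `a_k²L^{−2}` FAILS for the operators of record**: on the one-site carrier (H = 0, all
averages = 1, a = a_k = 1, L = 2 — every hypothesis of §1 holds: QQ^* = 1, α + β ≠ 0, both arguments invertible) one has `G_k = 1`, `Δ_k = 0`,
`C^{(k)} = 4·1`, `G^η_{k+1} = 5·1`, and `G_k + a_k²L^{−2}·G_kQ_k^*C^{(k)}Q_kG_k = 2·1 ≠ G^η_{k+1}` (whereas with `a_k²`: `1 + 4 = 5`, §1).  Reading note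
G-C2-25 (owner r16 to rule). [cite: BalabanImbrieJaffe1988, p.311 (Sect. 5.14)] -/
theorem composition311_asPrinted_fails :
    ∃ S : StepData ℝ Unit Unit Unit, S.Q * S.Qs = 1 ∧ S.α + S.β ≠ 0 ∧ IsUnit (S.H + S.α • S.Pk) ∧ IsUnit (S.β • S.P + S.Δk) ∧
      S.α = 1 ∧ S.β = 1 * (2 : ℝ)⁻¹ ^ 2 ∧
      S.Gk + (1 ^ 2 * (2 : ℝ)⁻¹ ^ 2) • (S.Gk * S.Qks * S.Ck * S.Qk * S.Gk) ≠ S.Gk1 := by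
  refine ⟨(StepData.mk 0 1 1 1 1 1 (1 * (2 : ℝ)⁻¹ ^ 2) : StepData ℝ Unit Unit Unit), (witness_hyps rfl).1, (witness_hyps rfl).2.1, (witness_hyps rfl).2.2.1, (witness_hyps rfl).2.2.2, rfl, rfl, ?_⟩
  rw [witness_lhs rfl, witness_Gk1 rfl]
  intro h
  have h1 := eq_of_smul_one_unit_eq h
  norm_num at h1

/-- … while on the same datum the identity with the FORCED coefficient `a_k² = 1` holds (instance of §1): `1 + 4·1 = 5·1`.
[cite: BalabanImbrieJaffe1988, p.311 (Sect. 5.14)] -/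
theorem composition311_witness_holds :
    ∃ S : StepData ℝ Unit Unit Unit, S.Q * S.Qs = 1 ∧ S.α + S.β ≠ 0 ∧ IsUnit (S.H + S.α • S.Pk) ∧ IsUnit (S.β • S.P + S.Δk) ∧
      S.α = 1 ∧ S.β = 1 * (2 : ℝ)⁻¹ ^ 2 ∧
      S.Gk + (1 : ℝ) ^ 2 • (S.Gk * S.Qks * S.Ck * S.Qk * S.Gk) = S.Gk1 :=
  ⟨(StepData.mk 0 1 1 1 1 1 (1 * (2 : ℝ)⁻¹ ^ 2) : StepData ℝ Unit Unit Unit), (witness_hyps rfl).1, (witness_hyps rfl).2.1, (witness_hyps rfl).2.2.1, (witness_hyps rfl).2.2.2, rfl, rfl,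
    composition311_step _ rfl (witness_hyps rfl).1 (witness_hyps rfl).2.1 (witness_hyps rfl).2.2.1 (witness_hyps rfl).2.2.2⟩

end Witness

/-! ## §3  The localized version: the composed expression with `G_{k,loc}`, `C^{(k)}_{loc}` = `G^η_{k+1}` + the printed difference terms -/

section Localized

variable {R : Type*} [Ring R]

/-- **«There are also small terms involving G_{k,loc}(u_{k+1}) − G_k(□,u_{k+1}), C^{(k)}_{loc}(u_{k+1}) − C^{(k)}(□,u_{k+1})», EXACT**: in any
ring, replacing `G ↦ G′ = G + D₁` and `C ↦ C′ = C + E` in the composed expression gives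
`G′ + c·G′XC′YG′ = (G + c·GXCYG) + [D₁ + c·(D₁XC′YG′ + GXEYG′ + GXCYD₁)]` — each remainder term carries exactly one of the differences
`D₁`, `E` (telescoping in the first slot that differs). [cite: BalabanImbrieJaffe1988, p.311 (Sect. 5.14)] -/
theorem composition311_localized (c : ℤ) (G D₁ C E X Y : R) :
    (G + D₁) + c • ((G + D₁) * X * (C + E) * Y * (G + D₁))
      = (G + c • (G * X * C * Y * G)) + (D₁ + c • (D₁ * X * (C + E) * Y * (G + D₁) + G * X * E * Y * (G + D₁) + G * X * C * Y * D₁)) := by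
  simp only [mul_add, add_mul, smul_add]
  abel

/-- The same with a REAL coefficient `c` (an `ℝ`-algebra; `c = a_k²`). [cite: BalabanImbrieJaffe1988, p.311 (Sect. 5.14)] -/
theorem composition311_localized_real {A : Type*} [Ring A] [Algebra ℝ A] (c : ℝ) (G D₁ C E X Y : A) :
    (G + D₁) + c • ((G + D₁) * X * (C + E) * Y * (G + D₁))
      = (G + c • (G * X * C * Y * G)) + (D₁ + c • (D₁ * X * (C + E) * Y * (G + D₁) + G * X * E * Y * (G + D₁) + G * X * C * Y * D₁)) := by
  simp only [mul_add, add_mul, smul_add]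
  abel

variable {ι κ ν : Type*} [Fintype ι] [Fintype κ] [Fintype ν] [DecidableEq ι] [DecidableEq κ] [DecidableEq ν]

/-- **The localized composition on [7]'s carrier**: with `G_{k,loc} = G_k + D₁`, `C^{(k)}_{loc} = C^{(k)} + E` (the printed differences as
data) and the hypotheses of `composition311_step`,
`G_{k,loc} + a_k²·G_{k,loc}Q_k^*C^{(k)}_{loc}Q_kG_{k,loc} = G^η_{k+1} + R`, `R = D₁ + a_k²·(D₁Q_k^*C_{loc}Q_kG_{loc} + G_kQ_k^*EQ_kG_{loc} +
G_kQ_k^*C^{(k)}Q_kD₁)`. [cite: BalabanImbrieJaffe1988, p.311 (Sect. 5.14)] -/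
theorem composition311_localized_step (S : StepData ℝ ι κ ν) {ak : ℝ} (hα : S.α = ak) (hQ : S.Q * S.Qs = 1)
    (hαβ : S.α + S.β ≠ 0) (hG : IsUnit (S.H + S.α • S.Pk)) (hC : IsUnit (S.β • S.P + S.Δk)) (D₁ : Matrix ι ι ℝ) (E : Matrix κ κ ℝ) :
    (S.Gk + D₁) + ak ^ 2 • ((S.Gk + D₁) * S.Qks * (S.Ck + E) * S.Qk * (S.Gk + D₁))
      = S.Gk1 + (D₁ + ak ^ 2 • (D₁ * S.Qks * (S.Ck + E) * S.Qk * (S.Gk + D₁) + S.Gk * S.Qks * E * S.Qk * (S.Gk + D₁)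
          + S.Gk * S.Qks * S.Ck * S.Qk * D₁)) := by
  rw [← composition311_step S hα hQ hαβ hG hC]
  simp only [Matrix.mul_add, Matrix.add_mul, smul_add]
  abel

/-- … and with the third printed difference `D₂ = G_{k+1,loc} − G^η_{k+1}` («and G_{k+1,loc}(u_{k+1}) − G_{k+1}(□,u_{k+1})»): the composed
localized expression equals `G^η_{k+1,loc} + (R − D₂)` — *"We end up with scalar field propagators G^η_{k+1,loc}(u_{k+1})"* plus the named small
terms. [cite: BalabanImbrieJaffe1988, p.311 (Sect. 5.14)] -/
theorem composition311_localized_step' (S : StepData ℝ ι κ ν) {ak : ℝ} (hα : S.α = ak) (hQ : S.Q * S.Qs = 1)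
    (hαβ : S.α + S.β ≠ 0) (hG : IsUnit (S.H + S.α • S.Pk)) (hC : IsUnit (S.β • S.P + S.Δk))
    (D₁ D₂ : Matrix ι ι ℝ) (E : Matrix κ κ ℝ) :
    (S.Gk + D₁) + ak ^ 2 • ((S.Gk + D₁) * S.Qks * (S.Ck + E) * S.Qk * (S.Gk + D₁))
      = (S.Gk1 + D₂) + ((D₁ + ak ^ 2 • (D₁ * S.Qks * (S.Ck + E) * S.Qk * (S.Gk + D₁) + S.Gk * S.Qks * E * S.Qk * (S.Gk + D₁)
          + S.Gk * S.Qks * S.Ck * S.Qk * D₁)) - D₂) := by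
  rw [composition311_localized_step S hα hQ hαβ hG hC]; abel

end Localized

/-! ### The size of the difference terms: «small (O(e^{−cr(e_k)}))» from the smallness of the printed differences -/

section Norm

variable {A : Type*} [NormedRing A] [NormedAlgebra ℝ A]

/-- **Operator-norm bound of the remainder** `R = D₁ + c·(D₁XC′YG′ + GXEYG′ + GXCYD₁)` in a normed `ℝ`-algebra (sub-multiplicative norm):
`‖R‖ ≤ ‖D₁‖ + |c|(‖D₁‖‖X‖‖C′‖‖Y‖‖G′‖ + ‖G‖‖X‖‖E‖‖Y‖‖G′‖ + ‖G‖‖X‖‖C‖‖Y‖‖D₁‖)`. [cite: BalabanImbrieJaffe1988, p.311 (Sect. 5.14)] -/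
theorem norm_remainder311_le (c : ℝ) (G G' D₁ C C' E X Y : A) :
    ‖D₁ + c • (D₁ * X * C' * Y * G' + G * X * E * Y * G' + G * X * C * Y * D₁)‖
      ≤ ‖D₁‖ + |c| * (‖D₁‖ * ‖X‖ * ‖C'‖ * ‖Y‖ * ‖G'‖ + ‖G‖ * ‖X‖ * ‖E‖ * ‖Y‖ * ‖G'‖ + ‖G‖ * ‖X‖ * ‖C‖ * ‖Y‖ * ‖D₁‖) := by
  have h5 : ∀ a₁ a₂ a₃ a₄ a₅ : A, ‖a₁ * a₂ * a₃ * a₄ * a₅‖ ≤ ‖a₁‖ * ‖a₂‖ * ‖a₃‖ * ‖a₄‖ * ‖a₅‖ := by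
    intro a₁ a₂ a₃ a₄ a₅
    calc ‖a₁ * a₂ * a₃ * a₄ * a₅‖ ≤ ‖a₁ * a₂ * a₃ * a₄‖ * ‖a₅‖ := norm_mul_le _ _
      _ ≤ ‖a₁ * a₂ * a₃‖ * ‖a₄‖ * ‖a₅‖ := by gcongr; exact norm_mul_le _ _
      _ ≤ ‖a₁ * a₂‖ * ‖a₃‖ * ‖a₄‖ * ‖a₅‖ := by gcongr; exact norm_mul_le _ _
      _ ≤ ‖a₁‖ * ‖a₂‖ * ‖a₃‖ * ‖a₄‖ * ‖a₅‖ := by gcongr; exact norm_mul_le _ _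
  calc ‖D₁ + c • (D₁ * X * C' * Y * G' + G * X * E * Y * G' + G * X * C * Y * D₁)‖
      ≤ ‖D₁‖ + ‖c • (D₁ * X * C' * Y * G' + G * X * E * Y * G' + G * X * C * Y * D₁)‖ := norm_add_le _ _
    _ = ‖D₁‖ + |c| * ‖D₁ * X * C' * Y * G' + G * X * E * Y * G' + G * X * C * Y * D₁‖ := by
        rw [norm_smul, Real.norm_eq_abs]
    _ ≤ ‖D₁‖ + |c| * (‖D₁ * X * C' * Y * G'‖ + ‖G * X * E * Y * G'‖ + ‖G * X * C * Y * D₁‖) := by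
        gcongr; exact norm_add₃_le
    _ ≤ ‖D₁‖ + |c| * (‖D₁‖ * ‖X‖ * ‖C'‖ * ‖Y‖ * ‖G'‖ + ‖G‖ * ‖X‖ * ‖E‖ * ‖Y‖ * ‖G'‖ + ‖G‖ * ‖X‖ * ‖C‖ * ‖Y‖ * ‖D₁‖) := by
        gcongr <;> exact h5 _ _ _ _ _

/-- **«small (O(e^{−cr(e_k)})) terms»**: if the two printed differences are small in operator norm, `‖G_{k,loc} − G_k(□)‖ ≤ δ` and
`‖C^{(k)}_{loc} − C^{(k)}(□)‖ ≤ δ` (the (2.31)/(2.47)-type inputs, rows C2.Eq2.31 / C2.Eq2.47 — hypotheses here), then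
`‖R‖ ≤ (1 + |c|·‖X‖‖Y‖·(‖C′‖‖G′‖ + ‖G‖‖G′‖ + ‖G‖‖C‖))·δ`; with δ = e^{−cr(e_k)} this is the printed order.
[cite: BalabanImbrieJaffe1988, p.311 (Sect. 5.14)] -/
theorem norm_remainder311_le_of_small (c : ℝ) {G G' D₁ C C' E X Y : A} {δ : ℝ} (hD : ‖D₁‖ ≤ δ) (hE : ‖E‖ ≤ δ) :
    ‖D₁ + c • (D₁ * X * C' * Y * G' + G * X * E * Y * G' + G * X * C * Y * D₁)‖
      ≤ (1 + |c| * (‖X‖ * ‖Y‖) * (‖C'‖ * ‖G'‖ + ‖G‖ * ‖G'‖ + ‖G‖ * ‖C‖)) * δ := by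
  have hδ : 0 ≤ δ := (norm_nonneg _).trans hD
  refine (norm_remainder311_le c G G' D₁ C C' E X Y).trans ?_
  have h1 : ‖D₁‖ * ‖X‖ * ‖C'‖ * ‖Y‖ * ‖G'‖ ≤ δ * ‖X‖ * ‖C'‖ * ‖Y‖ * ‖G'‖ := by gcongr
  have h2 : ‖G‖ * ‖X‖ * ‖E‖ * ‖Y‖ * ‖G'‖ ≤ ‖G‖ * ‖X‖ * δ * ‖Y‖ * ‖G'‖ := by gcongr
  have h3 : ‖G‖ * ‖X‖ * ‖C‖ * ‖Y‖ * ‖D₁‖ ≤ ‖G‖ * ‖X‖ * ‖C‖ * ‖Y‖ * δ := by gcongr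
  have hc : 0 ≤ |c| := abs_nonneg c
  nlinarith [mul_nonneg hc (by positivity : 0 ≤ δ * ‖X‖ * ‖C'‖ * ‖Y‖ * ‖G'‖), norm_nonneg X, norm_nonneg Y, norm_nonneg G,
    norm_nonneg G', norm_nonneg C, norm_nonneg C', mul_le_mul_of_nonneg_left (add_le_add (add_le_add h1 h2) h3) hc]

end Norm

end

end Literature.MathematicalPhysics.QuantumFieldTheory.BalabanImbrieJaffe1984to88.BIJ88ScalarComposition311
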